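import Summits.BirchSwinnertonDyer.Rank1Residual.X6.RankZeroCertificateKernel
import Summits.BirchSwinnertonDyer.BirchSwinnertonDyer.Theorems.PrintX6DescentCertificateRoad
import HarnessLib

/-!
# Class X6 ∧ analytic rank `0` — what a certificate record CLAIMS about its curve, and `BSD(E,p)` for the
# record's curve on each of the cell's roads

Cell `bsd-print-x6` (D-0131 (2) print tier, key `x6`; HOME `run/shared/lean/pub/bsd-print-x6/`), typer seat ty3.
Companion of `RankZeroCertificateSchema.lean` (FORMAT + recheck), `RankZeroCertificateKernel.lean` (instances,
`ClassX6`, `BSTWScope.HasWitness` PROVED from the recheck) and the data files `RankZeroCertificateRecords*.lean`.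
PARTITION (D-0054): leaf X6 ∧ r = 0 (K3 row A6) — types-the-object-of; closes NONE (every `BSD(E,p)` below is per
pair and CONDITIONAL on the named inputs it lists). HONEST FRAMING: BSD is not proved here for any class; the
unrefereed preprint BSTW arXiv:2409.01350 enters only as the tree's labelled OPEN binders, taken as hypotheses;
published results are consumed BY NAME.

## What a record CLAIMS (`Record.Claim`, a `Prop` to be ASSUMED — the two-engine computation)
`W.analyticRank = 0`, Miller's `#Ш_an(W) = r.shaAn`, `#E(ℚ)_tors = r.torsion`, `∏ c_ℓ = r.tamagawaProduct` — the
OUTPUT of engine T (Cremona's tables: exact modular-symbol `L(E,1)/Ω`, hence `#Ш_an`) and engine P (PARI/GP via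
cypari2 on the kit farm: `ellanalyticrank`, `ellbsd`, `elltors`, `ellglobalred`, + `msfromell` where `N ≤ 3·10⁴`;
job ids in each record's `engines`), which agree pair by pair. Nothing in the tree proves it.

## `BSD(E,p)` for the record's curve, per road (all CONDITIONAL, inputs by name; `ClassX6` PROVED)
* `Record.bsdp_of_lowerBound` — the SOCKET: `r_an = 0` (claim) + ANY proof of `MissingLowerBoundAt W p` ⇒ `BSD(E,p)`
  by the published upper half (Wuthrich 2014 Prop. 21; GZK; modularity:
  `Typed.X6.bsdp_of_missingLowerBoundAt_of_analyticRank_eq_zero`).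
* `Record.bsdp_of_BSTW13_OPEN` — the PRINT road (prover p1): the printed OPEN binder `BurungaleSkinnerTianWan2024_thm13_OPEN`
  + the published ± rank-zero inputs by name (`Supersingular.X6.bsdp_of_BSTW13_OPEN_of_analyticRank_eq_zero`).
* `Record.bsdp_of_thm13_scoped_OPEN` — the CELL-VERIFIED SCOPE road at `p ≥ 5`: the scoped binder + the record's
  KERNEL scope witness (`Supersingular.X6.bsdp_of_thm13_scoped_OPEN_of_analyticRank_eq_zero`).
* `Record.bsdp_of_card_selmerGroup_primePow` — the DESCENT road (prover p4, Cassels–Tate-free): an exact Selmer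
  cardinality `#Sel^(p^k)(E/ℚ) = p^m`, `ord_p #Ш_an ≤ m` (`PrintX6.X6.bsdp_rankZero_of_card_selmerGroup_primePow`);
  `Record.bsdp_of_sha_dvd` / `…_of_exists_sha_torsion` — the older Cassels–Tate form: a certificate `p ∣ #Ш(E/ℚ)` when
  `ord_p #Ш_an ≤ 2` (`Typed.missingLowerBoundAt_of_casselsTate_of_pow_dvd`).
* `Record.missingLowerBoundAt_of_not_dvd` / `bsdp_of_not_dvd` — the UNIT road (prover p2): `p ∤ #Ш_an`.
* §6: list forms over a `certified` records file with the instance binders discharged by the recheck.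

References: Wuthrich 2014 Prop. 21 [Wuthrich2014]; Kobayashi 2003 Thm. 1.2 [Kobayashi2003]; B. D. Kim 2013 Cor. 3.15
[BDKim2013]; Silverman *AEC* X.4.14 [SilvermanAEC2009]; Miller 2011 Def. 1.1 [Miller2011LMS]; Burungale–Skinner–Tian–Wan
arXiv:2409.01350v2 Thm. 1.3 (PRE, OPEN binder only) [BurungaleSkinnerTianWan2024].
-/

set_option autoImplicit false

noncomputable section

open scoped Classical MatrixGroups ModularForm

open CongruenceSubgroup WeierstrassCurve Literature.NumberTheory.EllipticCurves
  Literature.NumberTheory.EllipticCurves.ModularForms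
  Literature.NumberTheory.EllipticCurves.Rank1Residual
  Literature.NumberTheory.EllipticCurves.Rank1Residual.Typed
  Literature.NumberTheory.EllipticCurves.Rank1Residual.X11RankOneCertificates
  Literature.NumberTheory.QuadraticFields
  Summit.BirchSwinnertonDyer.BirchSwinnertonDyer.Rank1Residual.IntModel
  Summit.BirchSwinnertonDyer.BirchSwinnertonDyer.Rank1Residual.X11RankOne
  Summit.BirchSwinnertonDyer.Rank1Residual.Supersingular

namespace Summit.BirchSwinnertonDyer.Rank1Residual.X6.PrintCert
/-! ### §5 What a record CLAIMS (the two-engine computation), and `BSD(E,p)` per road -/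

namespace Record

/-- **What a certificate record CLAIMS about its curve** `W = r.curve` (Cremona's reduced minimal model):
analytic rank `0`; Miller's `#Ш_an(W) = r.shaAn`; `#E(ℚ)_tors = r.torsion`; `∏ c_ℓ = r.tamagawaProduct`.
Each conjunct is the OUTPUT of the two-engine computation named in `r.engines` (engine T: Cremona's
`allcurves/allbsd` = exact modular-symbol `L(E,1)/Ω` and `#Ш_an`; engine P: PARI/GP `ellanalyticrank`,
`ellbsd`, `elltors`, `ellglobalred` on the kit farm), agreeing pair by pair. A `Prop` to be ASSUMED,
`(h : r.Claim)`; nothing in the tree proves it. [folklore] -/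
def Claim (r : Record) : Prop :=
  ∀ [Fact r.p.Prime] [r.curve.IsElliptic] [r.curve.IsGloballyMinimal],
    r.curve.analyticRank = 0 ∧
    _root_.Literature.NumberTheory.EllipticCurves.shaAn r.curve = ((r.shaAn : ℚ) : ℂ) ∧
    r.curve.torsionOrder = r.torsion ∧ r.curve.tamagawaProduct = r.tamagawaProduct

end Record

/-- The claims of a list of records: every record's `Claim`. [folklore] -/
def Claims (rs : List Record) : Prop := ∀ r ∈ rs, r.Claim

namespace Record

variable (r : Record) [Fact r.p.Prime] [r.curve.IsElliptic] [r.curve.IsGloballyMinimal]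

/-- **The SOCKET.** For a certified record whose claim holds, ANY proof of the typed missing input
`MissingLowerBoundAt W p` (`ord_p #Ш_an ≤ ord_p #Ш`) gives Miller's `BSD(E,p)`: `ClassX6` is proved from the
recheck, `r_an = 0` is the claim, the upper half is Wuthrich 2014 Prop. 21 (`hW`; image proviso automatic on
X6 by Serre), GZK (`hGZK`) and modularity (`hmod`) by name. [cite: Wuthrich2014, Prop. 21 (p. 400)]
[cite: Serre1972, §1.11 Prop. 12 and §5.4 Prop. 21 i)] [cite: Miller2011LMS, §1 and Def. 1.1] -/
theorem bsdp_of_lowerBound (hW : Wuthrich2014.sha_dvd_analyticSha)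
    (hGZK : rank_eq_analyticRank_of_analyticRank_le_one) (hmod : hasEntireLFunction_rat)
    (hc : r.check = true) (h : r.Claim) (hlow : MissingLowerBoundAt r.curve r.p) : BSDp r.curve r.p :=
  Literature.NumberTheory.EllipticCurves.Rank1Residual.Typed.X6.bsdp_of_missingLowerBoundAt_of_analyticRank_eq_zero
    r.curve r.p hW hGZK hmod (r.three_le_of_check hc).2 (r.classX6_of_check hc) h.1 hlow

/-- **UNIT road (prover p2).** If `p ∤ #Ш_an` (claimed value), the lower bound is VACUOUS. (No sweep
residue pair is a unit pair; the lemma serves the complement of the residue.) [cite: Miller2011LMS, Def. 1.1] -/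
theorem missingLowerBoundAt_of_not_dvd (h : r.Claim) (hu : ¬ r.p ∣ r.shaAn) :
    MissingLowerBoundAt r.curve r.p := by
  refine ⟨r.shaAn, h.2.1, ?_⟩
  rw [padicValRat.of_nat, padicValNat.eq_zero_of_not_dvd hu]
  simp

/-- **UNIT road, `BSD(E,p)`**: Wuthrich + GZK + modularity + a certified record with `p ∤ #Ш_an`.
[cite: Wuthrich2014, Prop. 21 (p. 400)] [cite: Miller2011LMS, §1 and Def. 1.1] -/
theorem bsdp_of_not_dvd (hW : Wuthrich2014.sha_dvd_analyticSha)
    (hGZK : rank_eq_analyticRank_of_analyticRank_le_one) (hmod : hasEntireLFunction_rat)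
    (hc : r.check = true) (h : r.Claim) (hu : ¬ r.p ∣ r.shaAn) : BSDp r.curve r.p :=
  r.bsdp_of_lowerBound hW hGZK hmod hc h (r.missingLowerBoundAt_of_not_dvd h hu)

/-- **DESCENT road (prover p4).** Cassels–Tate squareness (`hCT`) + a finite certificate `p ∣ #Ш(E/ℚ)`
(e.g. `Sel_p(E/ℚ) ≠ 0` in rank `0`, `Typed.dvd_shaOrder_of_exists_torsion`) supply the lower bound when
`ord_p #Ш_an ≤ 2` (731 of the 734 sweep pairs have `#Ш_an = p²`·unit); then the socket.
[cite: SilvermanAEC2009, Thm. X.4.14] [cite: Wuthrich2014, Prop. 21 (p. 400)] [cite: Miller2011LMS, §1 and Def. 1.1] -/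
theorem bsdp_of_sha_dvd (hCT : exists_casselsTate_pairing (K := ℚ)) (hW : Wuthrich2014.sha_dvd_analyticSha)
    (hGZK : rank_eq_analyticRank_of_analyticRank_le_one) (hmod : hasEntireLFunction_rat)
    (hc : r.check = true) (h : r.Claim) (hv : padicValNat r.p r.shaAn ≤ 2) (hdvd : r.p ∣ r.curve.shaOrder) :
    BSDp r.curve r.p := by
  have hfin : r.curve.ShaFinite := (hGZK r.curve (by rw [h.1]; norm_num)).2
  refine r.bsdp_of_lowerBound hW hGZK hmod hc h
    (missingLowerBoundAt_of_casselsTate_of_pow_dvd r.curve r.p hCT hfin h.2.1 (k := 1) ?_ (by simpa using hdvd))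
  rw [padicValRat.of_nat]; exact_mod_cast hv

/-- The same with the certificate in the shape a descent delivers: a nonzero element of `Ш(E/ℚ)` killed by `p`.
[cite: SilvermanAEC2009, Thm. X.4.14] [cite: Miller2011LMS, §1 and Def. 1.1] -/
theorem bsdp_of_exists_sha_torsion (hCT : exists_casselsTate_pairing (K := ℚ))
    (hW : Wuthrich2014.sha_dvd_analyticSha) (hGZK : rank_eq_analyticRank_of_analyticRank_le_one)
    (hmod : hasEntireLFunction_rat) (hc : r.check = true) (h : r.Claim) (hv : padicValNat r.p r.shaAn ≤ 2)
    (hsha : ∃ x : r.curve.sha, x ≠ 0 ∧ r.p • x = 0) : BSDp r.curve r.p :=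
  r.bsdp_of_sha_dvd hCT hW hGZK hmod hc h hv (dvd_shaOrder_of_exists_torsion r.curve r.p hsha)

/-- **DESCENT road, Cassels–Tate-free (prover p4's certificate road, by name).** An exact Selmer cardinality
`#Sel^(p^k)(E/ℚ) = p^m` with `ord_p #Ш_an ≤ m` (claimed value) gives `BSD(E,p)` through
`PrintX6.X6.bsdp_rankZero_of_card_selmerGroup_primePow` (Wuthrich Prop. 21 = Kato's bound, GZK, modularity; no
Cassels–Tate, no OPEN binder); `ClassX6` from the recheck, `r_an = 0` and `#Ш_an` from the claim. On the 731 residue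
pairs with `ord_p #Ш_an = 2` the expected certificate is `dim_𝔽_p Sel^(p)(E/ℚ) = 2` (`k = 1`, `m = 2`).
[cite: Wuthrich2014, Prop. 21 (p. 400)] [cite: SilvermanAEC2009, Thm X.4.2(a)] [cite: Miller2011LMS, §1 and Def. 1.1] -/
theorem bsdp_of_card_selmerGroup_primePow (hW : Wuthrich2014.sha_dvd_analyticSha)
    (hGZK : rank_eq_analyticRank_of_analyticRank_le_one) (hmod : hasEntireLFunction_rat)
    (hc : r.check = true) (h : r.Claim) {k m : ℕ}
    (hcard : Nat.card (r.curve.selmerGroup ((r.p ^ k : ℕ) : ℤ)) = r.p ^ m) (hv : padicValNat r.p r.shaAn ≤ m) :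
    BSDp r.curve r.p :=
  Summit.BirchSwinnertonDyer.BirchSwinnertonDyer.Theorems.PrintX6.X6.bsdp_rankZero_of_card_selmerGroup_primePow
    r.curve r.p hW hGZK hmod (r.three_le_of_check hc).2 (r.classX6_of_check hc) h.1 hcard h.2.1
    (by rw [padicValRat.of_nat]; exact_mod_cast hv)

/-- **PRINT road (prover p1).** IF the printed Thm. 1.3 of Burungale–Skinner–Tian–Wan (arXiv:2409.01350v2,
UNREFEREED — the tree's OPEN binder `BurungaleSkinnerTianWan2024_thm13_OPEN`, a hypothesis) holds, then
`BSD(E,p)` for every certified record whose claim holds, the rest PUBLISHED and by name (Wuthrich Prop. 21,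
Kobayashi 2003 Thm. 1.2, B. D. Kim 2013 Cor. 3.15, Pollack 2003, modularity ×2, GZK) through the tree's ±
rank-zero road `Supersingular.X6.bsdp_of_BSTW13_OPEN_of_analyticRank_eq_zero`; `ClassX6` from the recheck.
[claim: BurungaleSkinnerTianWan2024, status: under-review] [cite: Kobayashi2003, Thm. 1.2 and Conjecture (p. 2)]
[cite: Wuthrich2014, Prop. 21 (p. 400)] [cite: Miller2011LMS, §1 and Def. 1.1] -/
theorem bsdp_of_BSTW13_OPEN (hBSTW : BurungaleSkinnerTianWan2024_thm13_OPEN)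
    (hW : Wuthrich2014.sha_dvd_analyticSha) (h12 : Kobayashi2003.thm12_signedSelmerDual_finite_torsion)
    (hKim : BDKim2013.cor315_signedCharValue_rankZero)
    (hPollack : ∀ {N : ℕ} [NeZero N] {f : CuspForm (Gamma0 N) 2},
      pollack_exists_plusMinusPAdicLFunction (W := r.curve) (f := f) (p := r.p))
    (hmod : nonempty_modularParametrizationData) (hmod' : hasEntireLFunction_rat)
    (hGZK : rank_eq_analyticRank_of_analyticRank_le_one) (hc : r.check = true) (h : r.Claim) :
    BSDp r.curve r.p :=
  Summit.BirchSwinnertonDyer.Rank1Residual.Supersingular.X6.bsdp_of_BSTW13_OPEN_of_analyticRank_eq_zero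
    r.curve r.p hBSTW hW h12 hKim hPollack hmod hmod' hGZK (r.three_le_of_check hc).2 (r.classX6_of_check hc) h.1

/-- **CELL-VERIFIED-SCOPE road** (`p ≥ 5`, auxiliary datum with an odd inert prime): IF the scoped binder
`BurungaleSkinnerTianWan2024_thm13_scoped_OPEN` (UNREFEREED, cell-verified reading at `p ≥ 5`) holds, then
`BSD(E,p)` for the record's curve — the scope witness is the record's KERNEL theorem `hasWitness_of_check`.
[claim: BurungaleSkinnerTianWan2024, status: under-review] [cite: Wuthrich2014, Prop. 21 (p. 400)]
[cite: Miller2011LMS, §1 and Def. 1.1] -/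
theorem bsdp_of_thm13_scoped_OPEN (hBSTW : BurungaleSkinnerTianWan2024_thm13_scoped_OPEN)
    (hW : Wuthrich2014.sha_dvd_analyticSha) (h12 : Kobayashi2003.thm12_signedSelmerDual_finite_torsion)
    (hKim : BDKim2013.cor315_signedCharValue_rankZero)
    (hPollack : ∀ {N : ℕ} [NeZero N] {f : CuspForm (Gamma0 N) 2},
      pollack_exists_plusMinusPAdicLFunction (W := r.curve) (f := f) (p := r.p))
    (hmod : nonempty_modularParametrizationData) (hmod' : hasEntireLFunction_rat)
    (hGZK : rank_eq_analyticRank_of_analyticRank_le_one) (hc : r.check = true) (h : r.Claim)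
    (h5 : 5 ≤ r.p) (hD : r.auxDisc ≠ 0) (hodd : r.auxInert ≠ 2) : BSDp r.curve r.p :=
  Summit.BirchSwinnertonDyer.Rank1Residual.Supersingular.X6.bsdp_of_thm13_scoped_OPEN_of_analyticRank_eq_zero
    r.curve r.p hBSTW hW h12 hKim hPollack hmod hmod' hGZK h5 (r.classX6_of_check hc)
    (r.hasWitness_of_check hc hD hodd) h.1

end Record

/-! ### §6 List forms over a certified records file (instance binders discharged by the recheck) -/

/-- **PRINT road, list form, instance-free**: IF BSTW Thm. 1.3 (OPEN binder) holds, then for every record of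
a `certified` list whose claims hold, `BSD(E,p)` — with `Fact p.Prime`, `IsElliptic` and `IsGloballyMinimal`
of the record's model all DERIVED from the recheck. [claim: BurungaleSkinnerTianWan2024, status: under-review]
[cite: Wuthrich2014, Prop. 21 (p. 400)] [cite: Miller2011LMS, §1 and Def. 1.1] -/
theorem bsdp_of_certified_of_claims_of_BSTW13_OPEN (hBSTW : BurungaleSkinnerTianWan2024_thm13_OPEN)
    (hW : Wuthrich2014.sha_dvd_analyticSha) (h12 : Kobayashi2003.thm12_signedSelmerDual_finite_torsion)
    (hKim : BDKim2013.cor315_signedCharValue_rankZero)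
    (hPollack : ∀ (W : WeierstrassCurve ℚ) [W.IsElliptic] [W.IsGloballyMinimal] (p : ℕ) [Fact p.Prime]
      {N : ℕ} [NeZero N] {f : CuspForm (Gamma0 N) 2},
      pollack_exists_plusMinusPAdicLFunction (W := W) (f := f) (p := p))
    (hmod : nonempty_modularParametrizationData) (hmod' : hasEntireLFunction_rat)
    (hGZK : rank_eq_analyticRank_of_analyticRank_le_one)
    {rs : List Record} (hC : certified rs = true) (hcl : Claims rs) (r : Record) (hr : r ∈ rs) :
    haveI := r.fact_prime_of_check (check_of_mem_of_certified hC hr)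
    haveI := (r.elliptic_and_minimal_of_check (check_of_mem_of_certified hC hr)).1
    haveI := (r.elliptic_and_minimal_of_check (check_of_mem_of_certified hC hr)).2
    BSDp r.curve r.p := by
  have hc := check_of_mem_of_certified hC hr
  haveI := r.fact_prime_of_check hc
  haveI := (r.elliptic_and_minimal_of_check hc).1
  haveI := (r.elliptic_and_minimal_of_check hc).2
  exact r.bsdp_of_BSTW13_OPEN hBSTW hW h12 hKim (hPollack r.curve r.p) hmod hmod' hGZK hc (hcl r hr)

/-- **SOCKET, list form, instance-free**: for every record of a `certified` list whose claims hold, ANY proof of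
`MissingLowerBoundAt` for its curve gives `BSD(E,p)` (published inputs by name).
[cite: Wuthrich2014, Prop. 21 (p. 400)] [cite: Miller2011LMS, §1 and Def. 1.1] -/
theorem bsdp_of_certified_of_claims_of_lowerBound (hW : Wuthrich2014.sha_dvd_analyticSha)
    (hGZK : rank_eq_analyticRank_of_analyticRank_le_one) (hmod : hasEntireLFunction_rat)
    {rs : List Record} (hC : certified rs = true) (hcl : Claims rs) (r : Record) (hr : r ∈ rs)
    (hlow : MissingLowerBoundAt r.curve r.p) :
    haveI := r.fact_prime_of_check (check_of_mem_of_certified hC hr)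
    haveI := (r.elliptic_and_minimal_of_check (check_of_mem_of_certified hC hr)).1
    haveI := (r.elliptic_and_minimal_of_check (check_of_mem_of_certified hC hr)).2
    BSDp r.curve r.p := by
  have hc := check_of_mem_of_certified hC hr
  haveI := r.fact_prime_of_check hc
  haveI := (r.elliptic_and_minimal_of_check hc).1
  haveI := (r.elliptic_and_minimal_of_check hc).2
  exact r.bsdp_of_lowerBound hW hGZK hmod hc (hcl r hr) hlow

/-- **`ClassX6` for every record of a certified list, instance-free** (the leaf predicate of the partition,
kernel-checked per pair). [cite: SilvermanAEC2009, VII.5 Prop. 5.1(a) and (b)] -/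
theorem classX6_of_certified {rs : List Record} (hC : certified rs = true) (r : Record) (hr : r ∈ rs) :
    haveI := r.fact_prime_of_check (check_of_mem_of_certified hC hr)
    haveI := (r.elliptic_and_minimal_of_check (check_of_mem_of_certified hC hr)).1
    haveI := (r.elliptic_and_minimal_of_check (check_of_mem_of_certified hC hr)).2
    ClassX6 r.curve r.p := by
  have hc := check_of_mem_of_certified hC hr
  haveI := r.fact_prime_of_check hc
  haveI := (r.elliptic_and_minimal_of_check hc).1
  haveI := (r.elliptic_and_minimal_of_check hc).2
  exact r.classX6_of_check hc

end Summit.BirchSwinnertonDyer.Rank1Residual.X6.PrintCert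

end
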